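import Summits.QuantumFields.YangMills.Theorems.AlphaInputsT3ACv3NewtonLiftGaugeFrames
import Summits.QuantumFields.YangMills.Theorems.AlphaInputsT3ACv3OneBlockLift
import Summits.QuantumFields.YangMills.Theorems.AlphaInputsT3ACv3OneBlockLiftBounds
import Summits.QuantumFields.YangMills.Theorems.AlphaInputsT3ACv3OneBlockLiftCurl
import HarnessLib

/-!
# `AlphaInputsT3ACv3NewtonLiftOneBlockCert` — STRATEGY B for 2′, the (FL) row under OWNER RULING g24-№4, MAP #3 M19 (D-cert): **THE KERNEL CERTIFICATE OF THE REGIONAL NEWTON LIFT AT THE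
# KERNEL OF RECORD `obLift`** — ★alpha-2 g6's one-block exact lift (exactness `linAvgIter_obLiftL`, local sup bound `abs_obLift_le_local`, local curl bound `abs_curlAt_obLift_le_local`),
# twisted by the gauge frames `ψ_σ` of `…NewtonLiftGaugeFrames`, IS an admissible kernel `R₀` of `NewtonLiftFramed.exists_exact_lift_regional_window_kfree`: `𝔰𝔲`-valued, `‖R₀u‖ ≤ (1056∕L^k)‖u‖`,
# framed approximate right inverse with `κ = 4·1056·2ω` from the one-block oscillation `ω` of the relative stencil gauges, and the curl row `(1728 + 3·1056·2(η₀′+η′)L^k)∕L^{2k}` in the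
# plaquette gauges — lane `pub-balaban3d` ∕ cell `ym3-torus`, seat `ym-ust-19936-w4` (g2)

WHY (cell `ym3-torus` 2026-08-28: ★★OWNER g25 03:34:10Z «THE ONE-BLOCK KERNEL `obLift` IS COMPLETE IN THE TREE … scalar certificate rows of record: (E) `linAvgIter_obLiftL`, (B) `abs_obLift_le_local`
(ρ = 1056∕Lᵏ, ONE-block support), (C) `abs_curlAt_obLift_le_local` (ρ′ = 1728∕L^{2k}, three blocks) ⇒ M19 (cert = ★w4's p600961∕p602140 instantiated at `T := obLiftL`) is a by-`exact` job»;
19936-w7 not seated — this seat takes M19 (PROGRESS 6)).  THIS FILE is that instantiation, in the T³ letters of the kernel (`F : T3Family`, `P = F.P K`, `d = 3`, `k ≤ K`, `3 ≤ L^k`):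
* §1 `exists_byEntryTw_linearMap` — the twisted kernel `byEntryTw T ψ` as an `ℝ`-linear map on plain one-forms (the `R₀` slot of (D)); `obLift_rowB`, `obLift_rowC` — ★alpha-2's (B)∕(C)
  in the support-predicate currency of `…LinearLiftMatrixKernel` ∕ `…NewtonLiftTwistedKernel` (`N b c′ :⟺ c′₋ = coarsen k b₋`; `N′_{z;μ,ν} c′ :⟺ c′₋ ∈ {coarsen k z, coarsen k (z+e_μ), coarsen k (z+e_ν)}`).
* §2 ★★★ `exists_obLift_gaugeKernel` — for ANY family of stencil gauges `σ : PBond P k → GaugeTransf P 0 SU(n)` there is an `ℝ`-linear `R₀` (= `byEntryTw (obLiftL F K k) ψ_σ`) with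
  (α) `𝔰𝔲`-valuedness, (β) `‖R₀ u‖ ≤ (1056∕L^k)·‖u‖`, (γ) for every `U₀`, `c`, `ω`: if the relative gauges `σ_cσ_{c′}⁻¹` oscillate by `≤ ω` between a bond source of the two `k`-blocks
  of `c` and the centre of its block (`c′₋ = coarsen k b₋`), then `‖h_c*·Q^{(k)}(σ_c·R₀u·σ_c*)(c)·h_c − u(c)‖ ≤ (3+1)·L^k·((1056∕L^k)·(2ω·‖u‖))` = `8448·ω·‖u‖`, (δ) for every `U₀`, plaquette
  `(z;μ,ν)`, gauge `σ_{c₀}` with `U₀^{σ_{c₀}}` `η₀′`-flat and the `U₀^{σ_{c′}}` (`c′` from the three blocks) `η′`-flat on `(z,μ)`, `(z,ν)`: `‖curl(σ_{c₀}·R₀u·σ_{c₀}*)(z;μ,ν)‖ ≤ (1728∕(L^k)²)·‖u‖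
  + 3·((1056∕L^k)·(2(η₀′+η′)·‖u‖))` — the four kernel binders `(hRS, hRn, hRinv, hRcurl)` of `exists_exact_lift_regional_window_kfree` with `C_R = 1056`, `κ = 8448ω`,
  `C_curl = 1728 + 6336·L^k(η₀′+η′)` (k-free once `η = x∕L^k`).
HONEST FRAMING.  Instantiation by `exact` of this seat's abstract rows at ★alpha-2's kernel; the gauges, their flatness, `ω` (≤ `(η_c+η_{c′})·3·L^k` by `…RelativeGaugeDrift` once the block
is charted as a product set) and the START are INPUTS; `hLift` is NOT claimed (M22 = START ∘ this certificate ∘ `exists_exact_lift_regional_window_kfree`); the stub 2′χ, the crux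
`HistoryTailL` and any gap are NOT claimed; count-neutral helper toward R3 2′ (items 19936∕19935); registry untouched; nothing about d = 4, the continuum, or a mass gap; YM₃ on T³ is rung
R3, not Clay.

References: T. Bałaban, Commun. Math. Phys. 102 (1985) 277–309 [Balaban1985Variational] (Thm 1 (8) p.279, (11)–(15) pp.279–280); CMP 98 (1985) 17–51 [Balaban1985Averaging] ((8)–(13)
pp.18–19, (19) p.21); CMP 109 (1987) 249–301 [Balaban1987RG1] ((0.4), (0.11) p.253).
-/

set_option autoImplicit false

noncomputable section

open scoped Matrix.Norms.L2Operator Classical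
open NormedSpace
namespace Summit.QuantumFields.YangMills.Theorems.NewtonLiftFramed

open Finset
open Literature.MathematicalPhysics.QuantumFieldTheory.Balaban1983to89
open Literature.MathematicalPhysics.QuantumFieldTheory.Balaban1983to89.T3ContinuumYM3Torus
open Literature.MathematicalPhysics.QuantumFieldTheory.Balaban1983to89.T4AdjointCovarianceUnitary (lieSU)
open Literature.MathematicalPhysics.QuantumFieldTheory.Balaban1983to89.B5Eq118OneStroke (iterBlockOf)
open T4Continuum
open Summit.QuantumFields.Balaban3D.Carriers (coarsen)
open Summit.QuantumFields.YangMills.Theorems.AbelianEML (linAvgIter curlAt)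
open Summit.QuantumFields.YangMills.Theorems.AbelianEML.Tensor (le_standing)
open Summit.QuantumFields.YangMills.Theorems.AbelianEML.OneBlock (obLift obLiftL obLiftL_apply linAvgIter_obLiftL abs_obLift_le_local abs_curlAt_obLift_le_local)
open Summit.QuantumFields.YangMills.Theorems.LinearLiftMatrix (byEntryTw byEntryTw_def byEntryTw_mem linAvgIterM curlM)

/-! ## §1 The twisted kernel as a linear map; ★alpha-2's scalar rows in the support-predicate currency -/

section Letters

variable {n : Type*} [Fintype n] [DecidableEq n] {ι κ : Type*} [Fintype ι] [DecidableEq ι]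

omit [Fintype n] [DecidableEq n] in
/-- **THE TWISTED KERNEL IS `ℝ`-LINEAR IN THE DATA**: `byEntryTw T ψ` is (the underlying function of) an `ℝ`-linear map on plain one-forms — the `R₀` slot of
`NewtonLiftFramed.exists_exact_lift_regional_allL`. [folklore] -/
theorem exists_byEntryTw_linearMap (T : (ι → ℝ) →ₗ[ℝ] (κ → ℝ)) (ψ : κ → ι → Matrix n n ℂ →ₗ[ℝ] Matrix n n ℂ) :
    ∃ R : (ι → Matrix n n ℂ) →ₗ[ℝ] (κ → Matrix n n ℂ), ∀ A, R A = byEntryTw T ψ A := by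
  refine ⟨{ toFun := byEntryTw T ψ, map_add' := fun A B => ?_, map_smul' := fun t A => ?_ }, fun A => rfl⟩
  · funext b
    simp only [byEntryTw_def, Pi.add_apply, map_add, smul_add, sum_add_distrib]
  · funext b
    simp only [byEntryTw_def, Pi.smul_apply, LinearMap.map_smul, RingHom.id_apply, smul_sum]
    refine sum_congr rfl fun c _ => ?_
    rw [smul_comm]

end Letters

section OneBlock

variable {F : T3Family} {K k : ℕ} (hk : k ≤ K) (hn3 : 3 ≤ F.L ^ k)
include hk hn3

/-- **ROW (B) OF THE ONE-BLOCK KERNEL IN THE SUPPORT CURRENCY**: `|obLift f (b)| ≤ (1056∕L^k)·M` whenever `|f c′| ≤ M` on the support `N b = {c′ : c′₋ = coarsen k b₋}` (★alpha-2 g6's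
`abs_obLift_le_local`). [cite: Balaban1987RG1, (0.11) p.253] -/
theorem obLift_rowB : ∀ (f : PBond (F.P K) k → ℝ) (M : ℝ) (b : PBond (F.P K) 0), (∀ c' : PBond (F.P K) k, c'.src = coarsen k b.src → |f c'| ≤ M) →
    |obLiftL F K k f b| ≤ (1056 / (F.L : ℝ) ^ k) * M := fun f M b h => by
  rw [obLiftL_apply]; exact abs_obLift_le_local hk hn3 f b fun α => h ⟨coarsen k b.src, α⟩ rfl

/-- **ROW (C) OF THE ONE-BLOCK KERNEL IN THE SUPPORT CURRENCY** at the plaquette `(z; μ, ν)`, `μ ≠ ν`: `|curl (obLift f)(z;μ,ν)| ≤ (1728∕(L^k)²)·M` whenever `|f c′| ≤ M` on the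
support `N′ = {c′ : c′₋ ∈ {coarsen k z, coarsen k (z+e_μ), coarsen k (z+e_ν)}}` (★alpha-2 g6's `abs_curlAt_obLift_le_local`). [cite: Balaban1987RG1, (0.4)+(0.11) p.253] -/
theorem obLift_rowC (z : Site (F.P K) 0) {μ ν : Fin 3} (hμν : μ ≠ ν) : ∀ (f : PBond (F.P K) k → ℝ) (M : ℝ),
    (∀ c' : PBond (F.P K) k, (c'.src = coarsen k z ∨ c'.src = coarsen k (z.shift μ) ∨ c'.src = coarsen k (z.shift ν)) → |f c'| ≤ M) →
    |curlAt (obLiftL F K k f) z μ ν| ≤ (1728 / ((F.L : ℝ) ^ k) ^ 2) * M := fun f M h => by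
  have hM0 : 0 ≤ M := (abs_nonneg _).trans (h ⟨coarsen k z, μ⟩ (Or.inl rfl))
  have e : (obLiftL F K k f : PBond (F.P K) 0 → ℝ) = obLift F K k f := rfl
  rw [e]
  exact abs_curlAt_obLift_le_local hk hn3 f z hμν hM0 fun y α hy => h ⟨y, α⟩ hy

end OneBlock

/-! ## §2 The certificate -/

section Cert

variable {n : Type*} [Fintype n] [DecidableEq n] [Nonempty n] {F : T3Family} {K k : ℕ}

/-- **★★★ THE KERNEL CERTIFICATE OF THE REGIONAL NEWTON LIFT AT `obLift` (MAP #3 M19).**  `k ≤ K`, `3 ≤ L^k`; stencil gauges `σ : PBond P k → GaugeTransf P 0 SU(n)` (one per coarse bond,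
`P = F.P K`).  There is an `ℝ`-linear kernel `R₀` on plain one-forms — the one-block lift twisted by the gauge frames, `R₀ u (b) = Σ_{c′} obLift-kernel(b,c′)·ψ_σ(b,c′)(u c′)` — such that:
(α) `R₀ u` is `𝔰𝔲(n)`-valued for `𝔰𝔲(n)`-valued `u`; (β) `‖R₀ u‖ ≤ (1056∕L^k)·‖u‖`; (γ) for every finest field `U₀` (only through the gauges' meaning), every coarse bond `c` and `ω ≥ 0`:
if `‖σ_c(b₋)σ_{c′}(b₋)⁻¹ − σ_c^{(k)}(c′₋)σ_{c′}^{(k)}(c′₋)⁻¹‖ ≤ ω` for every finest `b` of the two `k`-blocks of `c` and `c′` with `c′₋ = coarsen k b₋`, then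
`‖h_c*·Q^{(k)}(b ↦ σ_c(b₋)(R₀u)_bσ_c(b₋)*)(c)·h_c − u(c)‖ ≤ ((3+1)·L^k)·((1056∕L^k)·((2ω)·‖u‖))` (`= 8448·ω·‖u‖`); (δ) for every `U₀`, finest plaquette `(z;μ,ν)` (`μ ≠ ν`), gauge index `c₀`
and `η₀′, η′ ≥ 0`: if `U₀^{σ_{c₀}}` is `η₀′`-flat on `(z,μ)`, `(z,ν)` and `U₀^{σ_{c′}}` is `η′`-flat there for every `c′` from the blocks of `z+e_μ`, `z+e_ν`, `z`, then
`‖curl(b ↦ σ_{c₀}(b₋)(R₀u)_bσ_{c₀}(b₋)*)(z;μ,ν)‖ ≤ (1728∕(L^k)²)·‖u‖ + 3·((1056∕L^k)·((2(η₀′+η′))·‖u‖))`.  These are the binders `hRS`, `hRn` (`C_R = 1056`), `hRinv` (`κ = 8448ω`) and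
`hRcurl` (`C_curl = 1728 + 6336·L^k(η₀′+η′)`) of `exists_exact_lift_regional_window_kfree`. [cite: Balaban1985Variational, Thm 1 (8) p.279, (15) p.280; Balaban1985Averaging, (11)–(13) p.19, (19) p.21] -/
theorem exists_obLift_gaugeKernel (hk : k ≤ K) (hn3 : 3 ≤ F.L ^ k) (σ : PBond (F.P K) k → GaugeTransf (F.P K) 0 (Matrix.specialUnitaryGroup n ℂ)) :
    ∃ R₀ : (PBond (F.P K) k → Matrix n n ℂ) →ₗ[ℝ] (PBond (F.P K) 0 → Matrix n n ℂ),
      (∀ u : PBond (F.P K) k → Matrix n n ℂ, (∀ c, u c ∈ lieSU n) → ∀ b, R₀ u b ∈ lieSU n) ∧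
      (∀ u : PBond (F.P K) k → Matrix n n ℂ, ‖R₀ u‖ ≤ (1056 / (F.L : ℝ) ^ k) * ‖u‖) ∧
      (∀ (c : PBond (F.P K) k) (u : PBond (F.P K) k → Matrix n n ℂ) (ω : ℝ), 0 ≤ ω →
        (∀ b : PBond (F.P K) 0, (iterBlockOf k b.src = c.src ∨ iterBlockOf k b.src = c.tgt) → (iterBlockOf k b.tgt = c.src ∨ iterBlockOf k b.tgt = c.tgt) →
          ∀ c' : PBond (F.P K) k, c'.src = coarsen k b.src →
            ‖((σ c b.src * (σ c' b.src)⁻¹ : Matrix.specialUnitaryGroup n ℂ) : Matrix n n ℂ) -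
              ((transfUp (σ c) k c'.src * (transfUp (σ c') k c'.src)⁻¹ : Matrix.specialUnitaryGroup n ℂ) : Matrix n n ℂ)‖ ≤ ω) →
        ‖star (transfUp (σ c) k c.src : Matrix n n ℂ) *
              linAvgIterM k (fun b => ((σ c b.src : Matrix.specialUnitaryGroup n ℂ) : Matrix n n ℂ) * R₀ u b * star (σ c b.src : Matrix n n ℂ)) c *
              (transfUp (σ c) k c.src : Matrix n n ℂ) - u c‖ ≤
          ((((F.P K).d : ℝ) + 1) * (F.L : ℝ) ^ k) * ((1056 / (F.L : ℝ) ^ k) * ((2 * ω) * ‖u‖))) ∧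
      (∀ (U₀ : GaugeField (F.P K) 0 (Matrix.specialUnitaryGroup n ℂ)) (z : Site (F.P K) 0) (μ ν : Fin 3), μ ≠ ν →
        ∀ (c₀ : PBond (F.P K) k) (u : PBond (F.P K) k → Matrix n n ℂ) (η₀' η' : ℝ), 0 ≤ η₀' → 0 ≤ η' →
        (‖((GaugeField.gaugeAct (σ c₀) U₀ ⟨z, μ⟩ : Matrix.specialUnitaryGroup n ℂ) : Matrix n n ℂ) - 1‖ ≤ η₀' ∧
          ‖((GaugeField.gaugeAct (σ c₀) U₀ ⟨z, ν⟩ : Matrix.specialUnitaryGroup n ℂ) : Matrix n n ℂ) - 1‖ ≤ η₀') →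
        (∀ c' : PBond (F.P K) k, (c'.src = coarsen k z ∨ c'.src = coarsen k (z.shift μ) ∨ c'.src = coarsen k (z.shift ν)) →
          ‖((GaugeField.gaugeAct (σ c') U₀ ⟨z, μ⟩ : Matrix.specialUnitaryGroup n ℂ) : Matrix n n ℂ) - 1‖ ≤ η' ∧
          ‖((GaugeField.gaugeAct (σ c') U₀ ⟨z, ν⟩ : Matrix.specialUnitaryGroup n ℂ) : Matrix n n ℂ) - 1‖ ≤ η') →
        ‖curlM (fun b => ((σ c₀ b.src : Matrix.specialUnitaryGroup n ℂ) : Matrix n n ℂ) * R₀ u b * star (σ c₀ b.src : Matrix n n ℂ)) z μ ν‖ ≤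
          (1728 / ((F.L : ℝ) ^ k) ^ 2) * ‖u‖ + 3 * ((1056 / (F.L : ℝ) ^ k) * ((2 * (η₀' + η')) * ‖u‖))) := by
  -- the frames, the kernel, the support predicate
  obtain ⟨ψ, hψ⟩ := exists_gaugeFrames (k := k) σ
  obtain ⟨R₀, hR₀⟩ := exists_byEntryTw_linearMap (obLiftL F K k) ψ
  have hk' : k ≤ (F.P K).m + (F.P K).K := le_standing hk
  let N : PBond (F.P K) 0 → PBond (F.P K) k → Prop := fun b c' => c'.src = coarsen k b.src
  have hB : ∀ (f : PBond (F.P K) k → ℝ) (M : ℝ) (b : PBond (F.P K) 0), (∀ c', N b c' → |f c'| ≤ M) → |obLiftL F K k f b| ≤ (1056 / (F.L : ℝ) ^ k) * M :=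
    obLift_rowB hk hn3
  have hE : ∀ f : PBond (F.P K) k → ℝ, linAvgIter k (obLiftL F K k f) = f := linAvgIter_obLiftL hk hn3
  have hρ : (0 : ℝ) ≤ 1056 / (F.L : ℝ) ^ k := by positivity
  refine ⟨R₀, fun u hu b => ?_, fun u => ?_, fun c u ω hω hosc => ?_, fun U₀ z μ ν hμν c₀ u η₀' η' hη₀' hη' hflat₀ hflat => ?_⟩
  · -- (α)
    rw [hR₀]; exact byEntryTw_mem (obLiftL F K k) ψ (lieSU n) (fun b c X hX => gaugeFrame_mem_lieSU σ ψ hψ b c hX) hu b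
  · -- (β)
    rw [hR₀]; exact norm_byEntryTw_le_sup (obLiftL F K k) N hB hρ ψ (fun b c X => (norm_gaugeFrame_eq σ ψ hψ b c X).le) u
  · -- (γ)
    have h := hRinv_of_gaugeFrames (obLiftL F K k) N hB σ ψ hψ hk' hE c u (fun c' => norm_le_pi_norm u c') hω
      (fun b hb1 hb2 c' hc => hosc b hb1 hb2 c' hc)
    have e : (fun b : PBond (F.P K) 0 => ((σ c b.src : Matrix.specialUnitaryGroup n ℂ) : Matrix n n ℂ) * R₀ u b * star (σ c b.src : Matrix n n ℂ)) =
        fun b => ((σ c b.src : Matrix.specialUnitaryGroup n ℂ) : Matrix n n ℂ) * byEntryTw (obLiftL F K k) ψ u b * star (σ c b.src : Matrix n n ℂ) := by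
      funext b; rw [hR₀]
    rw [e]; exact h
  · -- (δ)
    have h := curlRow_of_gaugeFrames (obLiftL F K k) N hB σ ψ hψ
      (fun c' : PBond (F.P K) k => c'.src = coarsen k z ∨ c'.src = coarsen k (z.shift μ) ∨ c'.src = coarsen k (z.shift ν)) z (obLift_rowC hk hn3 z hμν)
      U₀ c₀ u (fun c' => norm_le_pi_norm u c') hη₀' hη' hflat₀ (fun b hb c' hc => hflat c' ?_)
    · have e : (fun b : PBond (F.P K) 0 => ((σ c₀ b.src : Matrix.specialUnitaryGroup n ℂ) : Matrix n n ℂ) * R₀ u b * star (σ c₀ b.src : Matrix n n ℂ)) =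
          fun b => ((σ c₀ b.src : Matrix.specialUnitaryGroup n ℂ) : Matrix n n ℂ) * byEntryTw (obLiftL F K k) ψ u b * star (σ c₀ b.src : Matrix n n ℂ) := by
        funext b; rw [hR₀]
      rw [e]; exact h
    · -- the support of a non-base bond of the plaquette lies in the three blocks
      rcases hb with e | e | e
      · subst e; exact Or.inr (Or.inl hc)
      · subst e; exact Or.inr (Or.inr hc)
      · subst e; exact Or.inl hc

end Cert

end Summit.QuantumFields.YangMills.Theorems.NewtonLiftFramed

end
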